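import Literature.NumberTheory.EllipticCurves.Pal2012.QuadraticTwistPeriodProofs
import HarnessLib

/-!
# Route `AdditiveBranchIMC`, cruxes `GordTwoRankZeroOffCaseOne` (stmt-19357) / `MultLower` (stmt-19359),
# stub U-a (`stub_genusGrossZagier[M]`) — part 3b: the SCALINGS of the two twisted models are
# `p`-adic units (Pal 2012 Prop. 2.5 in `ord_p` form)

Cell `bsd-addord`, seat `bsd-line-addord-w4` (stub-worker under the lead of crux 19357). HONEST
FRAMING: helper theorems only (no `def`, no named fact, nothing asserted about BSD; both cruxes
stay OPEN). The valuation identity of part 2 (`AdditiveBranchIMCGenusGrossZagierValuation.lean`)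
carries the binders `ord_p u(C₁) = 0`, `ord_p u(C₂) = 0` for the changes of variables presenting
the globally minimal `Wd`, `A` as `C₁ • E′^{(d₁)}`, `C₂ • E′^{(d₂)}`. On both roads `p ∥ d₁`,
`p ∤ d₂` and the globally minimal fourth curve `E′` is SEMISTABLE at `p` (good on the (G-ord) road,
multiplicative on the (M) road), so both binders are Pal 2012 Prop. 2.5 (`u_p = 1`), PROVED in the
tree at the place of `𝓞 ℚ` over `p` (`valuation_u_eq_one_of_smul_quadraticTwist_of_semistable_of_dvd`,
`…_of_odd_of_not_dvd`); this file reads them as `padicValRat p (u : ℚ) = 0`: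

* `padicValRat_eq_zero_of_valuation_eq_one` — the bridge `|x|_v = 1 ⇒ ord_p x = 0` (Mathlib's
  `valuation_equiv_padicValuation`).
* `padicValRat_u_eq_zero_of_twist_of_dvd` — `p` odd, `p ∥ d`, `V` good or multiplicative at `p`,
  `C • V^{(d)} = W` with `V`, `W` globally minimal ⇒ `ord_p u(C) = 0`.
* `padicValRat_u_eq_zero_of_twist_of_not_dvd` — `p` odd, `p ∤ d` ⇒ `ord_p u(C) = 0`.

References: Pal 2012 Prop. 2.5, Cor. 2.6; Silverman AEC VII.1 Prop. 1.3(b).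
-/

noncomputable section

open scoped Classical

open WeierstrassCurve NumberField IsDedekindDomain Rat.HeightOneSpectrum

-- D-0017 layout: summit = sub-problem, so `Summit.BirchSwinnertonDyer.BirchSwinnertonDyer.…` is the
-- mandated namespace (same option as the route's sockets files).
set_option linter.dupNamespace false
set_option autoImplicit false

namespace Summit.BirchSwinnertonDyer.BirchSwinnertonDyer.Theorems.GenusGrossZagier

/-- **`|x|_v = 1 ⇒ ord_p x = 0`** at the place `v` of `𝓞 ℚ` over `p` (the `v`-adic valuation of `ℚ`
is equivalent to the `p`-adic one, Mathlib `valuation_equiv_padicValuation`). [folklore] -/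
theorem padicValRat_eq_zero_of_valuation_eq_one (v : HeightOneSpectrum (𝓞 ℚ)) {p : ℕ}
    [Fact p.Prime] (hv : (primesEquiv v : ℕ) = p) {x : ℚ} (hx : x ≠ 0)
    (h : v.valuation ℚ x = 1) : padicValRat p x = 0 := by
  haveI : Fact (primesEquiv v : ℕ).Prime := ⟨(primesEquiv v).2⟩
  have h1 : Rat.padicValuation (primesEquiv v : ℕ) x = 1 :=
    (valuation_equiv_padicValuation v).eq_one_iff_eq_one.mp h
  subst hv
  have h2 : Rat.padicValuation (primesEquiv v : ℕ) x =
      WithZero.exp (-padicValRat (primesEquiv v : ℕ) x) := if_neg hx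
  rw [h2, ← WithZero.exp_zero, WithZero.exp_inj] at h1
  omega

/-- **`ord_p u(C) = 0` for `C • V^{(d)} = W` at an odd `p ∥ d` where `V` is semistable** (`V`, `W`
globally minimal): Pal 2012 Prop. 2.5, `u_p = 1` since `λ_{v_p}(V) = 0 < 6` — both `V^{(d)}` and
`W` are `p`-minimal (tree `valuation_u_eq_one_of_smul_quadraticTwist_of_semistable_of_dvd`), read
through `padicValRat_eq_zero_of_valuation_eq_one`. On the three-field road: `V = E′` (good at `p`
on the (G-ord) road, multiplicative on the (M) road), `d = d₁ ∋ p*`, `W = Wd`.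
[cite: Pal2012, Prop. 2.5 (odd ℓ ∣ d, λ < 6)] [cite: SilvermanAEC2009, VII.1 Prop. 1.3(b)] -/
theorem padicValRat_u_eq_zero_of_twist_of_dvd (V : WeierstrassCurve ℚ) [V.IsElliptic]
    [V.IsGloballyMinimal] {p : ℕ} [Fact p.Prime] (hp2 : p ≠ 2) {d : ℤ} (h1 : (p : ℤ) ∣ d)
    (h2 : ¬ (p : ℤ) ^ 2 ∣ d)
    (hV : V.HasGoodReductionAtPrime p ∨ V.HasMultiplicativeReductionAtPrime p)
    (W : WeierstrassCurve ℚ) [W.IsGloballyMinimal] (C : VariableChange ℚ)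
    (hC : C • V.quadraticTwist (d : ℚ) = W) : padicValRat p (C.u : ℚ) = 0 := by
  have hp : p.Prime := Fact.out
  obtain ⟨v, hv⟩ : ∃ v : HeightOneSpectrum (𝓞 ℚ), (primesEquiv v : ℕ) = p :=
    ⟨(primesEquiv (R := 𝓞 ℚ)).symm ⟨p, hp⟩, by rw [Equiv.apply_symm_apply]⟩
  subst hv
  have hV' : V.HasGoodReductionAt v ∨ V.HasMultiplicativeReductionAt v := by
    rcases hV with h | h
    · exact Or.inl ((hasGoodReductionAtPrime_iff_hasGoodReductionAt_ringOfIntegers v V).mp h)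
    · exact Or.inr
        ((V.hasMultiplicativeReductionAtPrime_iff_hasMultiplicativeReductionAt_ringOfIntegers v).mp h)
  refine padicValRat_eq_zero_of_valuation_eq_one v rfl C.u.ne_zero ?_
  exact V.valuation_u_eq_one_of_smul_quadraticTwist_of_semistable_of_dvd v hp2 h1 h2 hV' W C hC

/-- **`ord_p u(C) = 0` for `C • V^{(d)} = W` at an odd `p ∤ d`** (`V`, `W` globally minimal): Pal 2012
Prop. 2.5, `u_ℓ = 1` at an odd prime not dividing `d` (tree
`valuation_u_eq_one_of_smul_quadraticTwist_of_odd_of_not_dvd`). On the three-field road: `V = E′`,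
`d = d₂` (`p ∤ d₂`), `W = A`. [cite: Pal2012, Prop. 2.5 (odd ℓ ∤ d)] [cite: SilvermanAEC2009, VII.1 Prop. 1.3(b)] -/
theorem padicValRat_u_eq_zero_of_twist_of_not_dvd (V : WeierstrassCurve ℚ) [V.IsElliptic]
    [V.IsGloballyMinimal] {p : ℕ} [Fact p.Prime] (hp2 : p ≠ 2) {d : ℤ} (hd : ¬ (p : ℤ) ∣ d)
    (W : WeierstrassCurve ℚ) [W.IsGloballyMinimal] (C : VariableChange ℚ)
    (hC : C • V.quadraticTwist (d : ℚ) = W) : padicValRat p (C.u : ℚ) = 0 := by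
  have hp : p.Prime := Fact.out
  obtain ⟨v, hv⟩ : ∃ v : HeightOneSpectrum (𝓞 ℚ), (primesEquiv v : ℕ) = p :=
    ⟨(primesEquiv (R := 𝓞 ℚ)).symm ⟨p, hp⟩, by rw [Equiv.apply_symm_apply]⟩
  subst hv
  refine padicValRat_eq_zero_of_valuation_eq_one v rfl C.u.ne_zero ?_
  exact V.valuation_u_eq_one_of_smul_quadraticTwist_of_odd_of_not_dvd v hp2 hd W C hC

end Summit.BirchSwinnertonDyer.BirchSwinnertonDyer.Theorems.GenusGrossZagier

end
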